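import Literature.Computability.Complexity.CodeFPArith
import Literature.Computability.Complexity.AOWListMatrixFP
import Literature.Computability.Complexity.TwoColouringScan
import HarnessLib

/-!
# The 2-colouring scan runs in polynomial time on codes (`CodeFP`)

Support file for the discharge of `DyerEtAl2003.BISAPReducibleDownsets` (`BISDownsets.lean`,
`BISDownsetsProofs.lean`). The functional program of `TwoColouringScan.lean` — adjacency read off a
size and a bit string, the propagation/seeding scan `TwoColouring.colouring`, the test
`TwoColouring.proper` and the implication-matrix `TwoColouring.entries` — is computed on codes by
polynomial-time string functions, assembled in the typed `FP` algebra `CodeFP` (`CodeFP.lean`,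
`CodeFPArith.lean`: projections, tests, `map`/`all`/`any` over raw lists, bounded `foldl`,
`urange`, `rawGetD`, string `take`/`drop`). The only growth estimates are the accumulator bounds of
the two folds (colour lists have `n` items of value `≤ 2`, or values of the initial list; the
raw-code size lemma `LMat.length_rawE_le_mul` of `AOWListMatrixFP.lean` is reused).

Main statement: **`TwoColouring.coreFP`** — the map
`(n, v) ↦ (good, (n, entries))` (`TwoColouring.core`: `good` = "`|v| = n²` and the scan's colouring is
proper", `entries` = the implication matrix of the height-two order) is computed on the codes
`⟨bin n, v⟩ ↦ ⟨[good], ⟨bin n, listE bin entries⟩⟩`.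

## References

* S. Arora, B. Barak, *Computational Complexity: A Modern Approach*, CUP 2009, §1.3 (polynomial time
  is closed under composition and bounded loops) [AroraBarak2009].
* M. Dyer, L. A. Goldberg, C. Greenhill, M. Jerrum, Algorithmica 38 (2003), Theorem 5 [DyerEtAl2003].
-/

namespace Literature.Computability.Complexity

namespace TwoColouring

open _root_.Computability Polynomial Brick CodeFP

/-! ### Adjacency on codes -/

/-- The bit brick: `bit v k` read as the first symbol of `v ⇂ min k |v|`. [folklore] -/
theorem bit_eq_decide (v : List Bool) (k : ℕ) :
    bit v k = decide (((v.drop (min k v.length)).take 1) = [true]) := by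
  unfold bit
  by_cases hk : k < v.length
  · rw [min_eq_left hk.le, List.getD_eq_getElem _ _ hk, List.drop_eq_getElem_cons hk, List.take_succ_cons,
      List.take_zero]
    cases v[k] <;> simp
  · push Not at hk
    rw [min_eq_right hk, List.getD_eq_default _ _ hk, List.drop_of_length_le le_rfl]
    simp

/-- **`bit` on codes**: `(v, bin k) ↦ [bit v k]`. [cite: AroraBarak2009, §1.3] -/
theorem bitFP : CodeFP (pairE strE natE) bitE (fun p => bit p.1 p.2) := by
  have hv : CodeFP (pairE strE natE) strE (fun p => p.1) := fst _ _
  have hk : CodeFP (pairE strE natE) natE (fun p => p.2) := snd _ _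
  have hcnt : CodeFP (pairE strE natE) unE (fun p => min p.2 p.1.length) :=
    unOfNatMin.comp ((strLength.comp hv).pair hk)
  have htake : CodeFP (pairE strE natE) strE (fun p => (p.1.drop (min p.2 p.1.length)).take 1) :=
    strTake.comp ((const _ 1).pair (strDrop.comp (hcnt.pair hv)))
  have heq : CodeFP (pairE strE natE) bitE
      (fun p => decide ((p.1.drop (min p.2 p.1.length)).take 1 = [true])) :=
    (CodeFP.eq (eα := strE) Function.injective_id).comp (htake.pair (const _ [true]))
  exact heq.congr fun p => (bit_eq_decide p.1 p.2).symm

/-- Codes of the context `(m, v)`: size in unary, adjacency bits. [folklore] -/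
abbrev mvE : ℕ × List Bool → List Bool := pairE unE strE

/-- **`adj` on codes**: `((1ᵐ, v), (bin i, bin j)) ↦ [adj m v i j]`. [cite: AroraBarak2009, §1.3] -/
theorem adjFP : CodeFP (pairE mvE (pairE natE natE)) bitE (fun p => adj p.1.1 p.1.2 p.2.1 p.2.2) := by
  have hm : CodeFP (pairE mvE (pairE natE natE)) natE (fun p => p.1.1) := (natOfUn.comp (fst _ _).fst' :)
  have hv : CodeFP (pairE mvE (pairE natE natE)) strE (fun p => p.1.2) := (fst _ _).snd'
  have hi : CodeFP (pairE mvE (pairE natE natE)) natE (fun p => p.2.1) := (snd _ _).fst'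
  have hj : CodeFP (pairE mvE (pairE natE natE)) natE (fun p => p.2.2) := (snd _ _).snd'
  have hb1 : CodeFP (pairE mvE (pairE natE natE)) bitE (fun p => bit p.1.2 (p.2.2 + p.1.1 * p.2.1)) :=
    (bitFP.comp (hv.pair (natAdd.comp (hj.pair (natMul.comp (hm.pair hi))))) :)
  have hb2 : CodeFP (pairE mvE (pairE natE natE)) bitE (fun p => bit p.1.2 (p.2.1 + p.1.1 * p.2.2)) :=
    (bitFP.comp (hv.pair (natAdd.comp (hi.pair (natMul.comp (hm.pair hj))))) :)
  have he : CodeFP (pairE mvE (pairE natE natE)) bitE (fun p => p.2.1 == p.2.2) :=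
    (beq natE_injective).comp (hi.pair hj)
  exact (he.not.and (hb1.or hb2)).congr fun p => rfl

/-! ### Colour lists on codes -/

/-- Codes of colour lists: raw lists of binary numerals. [folklore] -/
abbrev colE : List ℕ → List Bool := rawE natE

/-- **`col` on codes** (`rawGetD`, the default `0` being coded by `ε`). [cite: AroraBarak2009, §1.3] -/
theorem colFP : CodeFP (pairE colE natE) natE (fun p => col p.1 p.2) := rawGetD natE natE_zero

/-- Codes of the context `((m, v), c)`. [folklore] -/
abbrev ctxE : (ℕ × List Bool) × List ℕ → List Bool := pairE mvE colE

/-- **`hasNbr` on codes**: `(((1ᵐ, v), c), (bin i, bin a)) ↦ [hasNbr m v c i a]`. [cite: AroraBarak2009, §1.3] -/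
theorem hasNbrFP : CodeFP (pairE ctxE (pairE natE natE)) bitE
    (fun p => hasNbr p.1.1.1 p.1.1.2 p.1.2 p.2.1 p.2.2) := by
  -- the predicate on `(σ, j)`, `σ = (((m, v), c), (i, a))`
  let σE : ((ℕ × List Bool) × List ℕ) × (ℕ × ℕ) → List Bool := pairE ctxE (pairE natE natE)
  have hadj : CodeFP (pairE σE natE) bitE (fun q => adj q.1.1.1.1 q.1.1.1.2 q.1.2.1 q.2) :=
    (adjFP.comp ((fst _ _).fst'.fst'.pair ((fst _ _).snd'.fst'.pair (snd _ _))) :)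
  have hcol : CodeFP (pairE σE natE) bitE (fun q => col q.1.1.2 q.2 == q.1.2.2) :=
    ((beq natE_injective).comp ((colFP.comp ((fst _ _).fst'.snd'.pair (snd _ _))).pair (fst _ _).snd'.snd') :)
  have hany := any (hadj.and hcol)
  exact ((hany.comp ((CodeFP.id σE).pair (urange.comp (fst _ _).fst'.fst'))).congr fun p => rfl :)

/-- **`recolour` on codes**: `(((1ᵐ, v), c), bin i) ↦ bin (recolour m v c i)`. [cite: AroraBarak2009, §1.3] -/
theorem recolourFP : CodeFP (pairE ctxE natE) natE (fun p => recolour p.1.1.1 p.1.1.2 p.1.2 p.2) := by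
  have hci : CodeFP (pairE ctxE natE) natE (fun p => col p.1.2 p.2) := (colFP.comp ((fst _ _).snd'.pair (snd _ _)) :)
  have hc2 : CodeFP (pairE ctxE natE) bitE (fun p => col p.1.2 p.2 == 2) :=
    (beq natE_injective).comp (hci.pair (const _ 2))
  have hh : ∀ a : ℕ, CodeFP (pairE ctxE natE) bitE (fun p => hasNbr p.1.1.1 p.1.1.2 p.1.2 p.2 a) := fun a =>
    (hasNbrFP.comp ((fst _ _).pair ((snd _ _).pair (const _ a))) :)
  have hin : CodeFP (pairE ctxE natE) natE
      (fun p => if hasNbr p.1.1.1 p.1.1.2 p.1.2 p.2 0 then 1 else if hasNbr p.1.1.1 p.1.1.2 p.1.2 p.2 1 then 0 else 2) :=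
    (hh 0).ite (const _ 1) ((hh 1).ite (const _ 0) (const _ 2))
  exact (hc2.ite hin hci).congr fun p => rfl

/-- **`propagate` on codes.** [cite: AroraBarak2009, §1.3] -/
theorem propagateFP : CodeFP ctxE colE (fun p => propagate p.1.1 p.1.2 p.2) :=
  ((map recolourFP).comp ((CodeFP.id ctxE).pair (urange.comp (fst _ _).fst'))).congr fun _ => rfl


/-! ### The folds: `close` and the scan (accumulator bounds by `LMat.length_rawE_le_mul`) -/

/-- **`close` on codes**: `n` clocked propagation rounds, a fold over a budget of `n` units; the
accumulator is a colour list of `n` items whose values are `≤ 2` or values of the initial list.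
[cite: AroraBarak2009, §1.3 (polynomially bounded loops)] -/
theorem closeFP : CodeFP ctxE colE (fun p => close p.1.1 p.1.2 p.2) := by
  have hstep : CodeFP (pairE ctxE (pairE unitE colE)) colE (fun t => propagate t.1.1.1 t.1.1.2 t.2.2) :=
    (propagateFP.comp ((fst _ _).fst'.pair (snd _ _).snd') :)
  have hinit : CodeFP ctxE colE (fun s => s.2) := snd _ _
  have h := foldl (σ := (ℕ × List Bool) × List ℕ) (α := Unit) (β := List ℕ) (eσ := ctxE) (eα := unitE)
    (eβ := colE) (step := fun s _ b => propagate s.1.1 s.1.2 b) (init := fun s => s.2) hstep hinit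
    (X * (2 * X + 6) + X) (fun s l₁ l₂ => by
      obtain ⟨⟨m, v⟩, c₀⟩ := s
      dsimp only
      rw [foldl_const_eq_iterate]
      set W := (pairE ctxE (rawE unitE) (((m, v), c₀), l₁ ++ l₂)).length with hW
      have hW' : W = 2 * (2 * (2 * m + 2 + v.length) + 2 + (colE c₀).length) + 2 +
          (rawE unitE (l₁ ++ l₂)).length := by
        simp only [hW, pairE_apply, length_boolPair, length_unE]
        rfl
      have hmW : m ≤ W := by omega
      have hcW : (colE c₀).length ≤ W := by omega
      simp only [eval_add, eval_mul, eval_X, eval_ofNat]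
      rcases Nat.eq_zero_or_pos l₁.length with hk | hk
      · rw [hk, Function.iterate_zero_apply]
        nlinarith
      · have hlen := length_iterate_propagate (n := m) v c₀ hk
        have hitems : ∀ x ∈ (propagate m v)^[l₁.length] c₀, (natE x).length ≤ W + 2 := by
          intro x hx
          rcases mem_iterate_propagate hx with hx | hx
          · exact (length_natE_le x).trans (by omega)
          · have h2 := length_item_le_length_rawE natE hx
            change 2 * (natE x).length + 2 ≤ (colE c₀).length at h2
            omega
        have hb := LMat.length_rawE_le_mul natE hitems
        rw [hlen] at hb
        calc (colE ((propagate m v)^[l₁.length] c₀)).length ≤ m * (2 * (W + 2) + 2) := hb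
          _ ≤ W * (2 * W + 6) + W := by nlinarith)
  exact (h.comp ((CodeFP.id ctxE).pair (replicateUnit.comp (fst _ _).fst'))).congr fun _ => rfl

/-- **`seed` on codes**: `(1ᵐ, (bin s, c)) ↦ seed m s c`. [cite: AroraBarak2009, §1.3] -/
theorem seedFP : CodeFP (pairE unE (pairE natE colE)) colE (fun p => seed p.1 p.2.1 p.2.2) := by
  let σE : ℕ × (ℕ × List ℕ) → List Bool := pairE unE (pairE natE colE)
  have hi : CodeFP (pairE σE natE) natE (fun q => q.2) := snd _ _
  have hs : CodeFP (pairE σE natE) natE (fun q => q.1.2.1) := (fst _ _).snd'.fst'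
  have hci : CodeFP (pairE σE natE) natE (fun q => col q.1.2.2 q.2) :=
    (colFP.comp ((fst _ _).snd'.snd'.pair hi) :)
  have hcond : CodeFP (pairE σE natE) bitE (fun q => (q.2 == q.1.2.1) && (col q.1.2.2 q.2 == 2)) :=
    ((beq natE_injective).comp (hi.pair hs)).and ((beq natE_injective).comp (hci.pair (const _ 2)))
  have hg : CodeFP (pairE σE natE) natE
      (fun q => if (q.2 == q.1.2.1) && (col q.1.2.2 q.2 == 2) then 0 else col q.1.2.2 q.2) :=
    hcond.ite (const _ 0) hci
  exact ((map hg).comp ((CodeFP.id σE).pair (urange.comp (fst _ _)))).congr fun _ => rfl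

/-- **`blank` on codes.** [folklore] -/
theorem blankFP : CodeFP unE colE blank := ((map₀ (const natE (2 : ℕ))).comp urange).congr fun _ => rfl

/-- **The scan on codes**: `(1ᵐ, v) ↦ colouring m v`, a fold over the seeds `[0, …, m)` whose
accumulator is a colour list of `m` items of value `≤ 2`.
[cite: AroraBarak2009, §1.3 (polynomially bounded loops)] -/
theorem colouringFP : CodeFP mvE colE (fun p => colouring p.1 p.2) := by
  have hstep : CodeFP (pairE mvE (pairE natE colE)) colE
      (fun t => close t.1.1 t.1.2 (seed t.1.1 t.2.1 t.2.2)) :=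
    (closeFP.comp ((fst _ _).pair (seedFP.comp ((fst _ _).fst'.pair (snd _ _)))) :)
  have hinit : CodeFP mvE colE (fun s => blank s.1) := (blankFP.comp (fst _ _) :)
  have h := foldl (σ := ℕ × List Bool) (α := ℕ) (β := List ℕ) (eσ := mvE) (eα := natE) (eβ := colE)
    (step := fun s a b => close s.1 s.2 (seed s.1 a b)) (init := fun s => blank s.1) hstep hinit (6 * X)
    (fun s l₁ l₂ => by
      obtain ⟨m, v⟩ := s
      dsimp only
      obtain ⟨hlen, hle⟩ := sizeInv_foldl v l₁ (sizeInv_blank m)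
      have hb := LMat.length_rawE_le_mul natE (E := 2) fun x hx => (length_natE_le x).trans (hle x hx)
      rw [hlen] at hb
      simp only [eval_mul, eval_ofNat, eval_X, pairE_apply, length_boolPair, length_unE]
      change (rawE natE _).length ≤ _
      omega)
  exact (h.comp ((CodeFP.id mvE).pair (urange.comp (fst _ _)))).congr fun _ => rfl

/-! ### The test and the implication matrix on codes -/

/-- Codes of the context `(((m, v), c), i)`. [folklore] -/
abbrev rowE : ((ℕ × List Bool) × List ℕ) × ℕ → List Bool := pairE ctxE natE

/-- `adj m v i j` on the row context. [folklore] -/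
theorem adjRowFP : CodeFP (pairE rowE natE) bitE (fun q => adj q.1.1.1.1 q.1.1.1.2 q.1.2 q.2) :=
  (adjFP.comp ((fst _ _).fst'.fst'.pair ((fst _ _).snd'.pair (snd _ _))) :)

/-- `[col c (g q) = 0]` on the row context. [folklore] -/
theorem colZeroRowFP {g : (((ℕ × List Bool) × List ℕ) × ℕ) × ℕ → ℕ} (hg : CodeFP (pairE rowE natE) natE g) :
    CodeFP (pairE rowE natE) bitE (fun q => col q.1.1.2 (g q) == 0) :=
  ((beq natE_injective).comp ((colFP.comp ((fst _ _).fst'.snd'.pair hg)).pair (const _ 0)) :)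

/-- **`proper` on codes.** [cite: AroraBarak2009, §1.3] -/
theorem properFP : CodeFP ctxE bitE (fun p => proper p.1.1 p.1.2 p.2) := by
  have hP : CodeFP (pairE rowE natE) bitE (fun q => !(adj q.1.1.1.1 q.1.1.1.2 q.1.2 q.2) ||
      !((col q.1.1.2 q.1.2 == 0) == (col q.1.1.2 q.2 == 0))) :=
    adjRowFP.not.or ((beq bitE_injective).comp ((colZeroRowFP (fst _ _).snd').pair
      (colZeroRowFP (snd _ _)))).not
  have hallj : CodeFP rowE bitE (fun r => (List.range r.1.1.1).all fun j =>
      !(adj r.1.1.1 r.1.1.2 r.2 j) || !((col r.1.2 r.2 == 0) == (col r.1.2 j == 0))) :=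
    ((all hP).comp ((CodeFP.id rowE).pair (urange.comp (fst _ _).fst'.fst'))).congr fun _ => rfl
  exact (((all hallj).comp ((CodeFP.id ctxE).pair (urange.comp (fst _ _).fst'))).congr fun _ => rfl :)

/-- **`entries` on codes.** [cite: AroraBarak2009, §1.3] -/
theorem entriesFP : CodeFP ctxE colE (fun p => entries p.1.1 p.1.2 p.2) := by
  have hent : CodeFP (pairE rowE natE) natE (fun q => entry q.1.1.1.1 q.1.1.1.2 q.1.1.2 q.1.2 q.2) :=
    (((colZeroRowFP (fst _ _).snd').not.and ((colZeroRowFP (snd _ _)).and adjRowFP)).ite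
      (const _ 1) (const _ 0)).congr fun _ => rfl
  have hrow : CodeFP rowE colE (fun r => (List.range r.1.1.1).map fun j =>
      entry r.1.1.1 r.1.1.2 r.1.2 r.2 j) :=
    ((map hent).comp ((CodeFP.id rowE).pair (urange.comp (fst _ _).fst'.fst'))).congr fun _ => rfl
  have htab : CodeFP ctxE (rawE colE) (fun p => (List.range p.1.1).map fun i =>
      (List.range p.1.1).map fun j => entry p.1.1 p.1.2 p.2 i j) :=
    ((map hrow).comp ((CodeFP.id ctxE).pair (urange.comp (fst _ _).fst'))).congr fun _ => rfl
  exact ((flatten natE).comp htab).congr fun _ => rfl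

/-! ### The core of the transducer -/

/-- **The typed core of the transducer of `#BIS ≤_AP #DOWNSETS`**: from the size `n` and the
adjacency bits `v` of a graph code, the bit `good` ("`|v| = n²` — the code is well formed — and the
scan's colouring is proper") and the `#DOWNSETS` instance `(n, entries)` (the implication matrix of
the height-two order with side `{colour 0}`), the scan being run with the capped size
`m = min n |v|` (`= n` on well-formed codes). [cite: DyerEtAl2003, Theorem 5] -/
def core (n : ℕ) (v : List Bool) : Bool × (ℕ × List ℕ) :=
  (decide (v.length = n * n) && proper (min n v.length) v (colouring (min n v.length) v),
    (n, entries (min n v.length) v (colouring (min n v.length) v)))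

/-- **The core is computed on codes in polynomial time**:
`⟨bin n, v⟩ ↦ ⟨[good], ⟨bin n, listE bin entries⟩⟩`. [cite: AroraBarak2009, §1.3] -/
theorem coreFP : CodeFP (pairE natE strE) (pairE bitE (pairE natE (listE natE))) (fun p => core p.1 p.2) := by
  have hn : CodeFP (pairE natE strE) natE (fun p => p.1) := fst _ _
  have hv : CodeFP (pairE natE strE) strE (fun p => p.2) := snd _ _
  have hm : CodeFP (pairE natE strE) unE (fun p => min p.1 p.2.length) :=
    unOfNatMin.comp ((strLength.comp hv).pair hn)
  have hmv : CodeFP (pairE natE strE) mvE (fun p => (min p.1 p.2.length, p.2)) := hm.pair hv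
  have hcol : CodeFP (pairE natE strE) colE (fun p => colouring (min p.1 p.2.length) p.2) :=
    (colouringFP.comp hmv :)
  have hctx : CodeFP (pairE natE strE) ctxE
      (fun p => ((min p.1 p.2.length, p.2), colouring (min p.1 p.2.length) p.2)) := hmv.pair hcol
  have hvalid : CodeFP (pairE natE strE) bitE (fun p => decide (p.2.length = p.1 * p.1)) :=
    (natEq.comp ((strNatLength.comp hv).pair (natMul.comp (hn.pair hn))) :)
  have hgood := hvalid.and (properFP.comp hctx)
  have hent : CodeFP (pairE natE strE) (listE natE)
      (fun p => entries (min p.1 p.2.length) p.2 (colouring (min p.1 p.2.length) p.2)) :=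
    ((listOfRaw natE).comp (entriesFP.comp hctx) :)
  exact (hgood.pair (hn.pair hent)).congr fun _ => rfl

end TwoColouring

end Literature.Computability.Complexity
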